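import Mathlib
import Literature.Analysis.FluidPDE.GalerkinFlow
import HarnessLib

/-!
# Stub `stub_meanZeroInvariant` — line `Sketch` of the crux `WazewskiBlock.UniformGalerkinTrap`

The mean mode is conserved by the Galerkin phase semiflow: for `ν ≥ 0`, an integrable mean-zero
force `f` and a phase point `x` whose mean mode vanishes, the `k = 0` component of
`galerkinPhaseFlow ν (f̂|_{≤N}) t x` vanishes for every `t ≥ 0`.

Proof. The `k = 0` component of the Galerkin vector field `galerkinRHS` vanishes on the whole
phase space: the Stokes term carries the factor `|0|² = 0`, the force coefficient is
`f̂(0) = complexify (∫ f) = 0`, and the convection symbol at the zero frequency is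
`∑ₗ (2πi ∑ⱼ c(l)ⱼ (−l)ⱼ) • c(−l) = 0` by transversality `l · c(l) = 0`. Hence the mean
coordinate of the forward orbit (a global solution of the Galerkin ODE,
`isGalerkinODESolution_galerkinCoeffFlow`) has zero right derivative on `[0, ∞)` and is constant
(`constant_of_has_deriv_right_zero`), equal to its vanishing initial value.
-/

noncomputable section
-- `Summit.<Summit>.<Problem>` is the tree's mandated summit-side namespace (CONVENTIONS §2); deliberate duplicate.
set_option linter.dupNamespace false
namespace Summit.AnomalousDissipation.AnomalousDissipation.Theorems.UniformGalerkinTrap.Sketch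
open MeasureTheory Set Filter Topology
open scoped ENNReal NNReal InnerProductSpace
open Literature.Analysis.FunctionSpaces Literature.Analysis.FunctionSpaces.Torus
open Literature.Analysis.FluidPDE

/-- The convection symbol of a transversal family vanishes at the zero frequency:
`∑_{l + m = 0} (2πi ∑ⱼ C(l)ⱼ mⱼ) • C'(m) = 0`, since `m = -l` and `l · C(l) = 0` on `S`. -/
theorem convectionCoeff_zero_freq_of_isTransversal {d : Type*} [Fintype d]
    {S : Finset (d → ℤ)} {C : (d → ℤ) → EuclideanSpace ℂ d} (hC : IsTransversal S C)
    (C' : (d → ℤ) → EuclideanSpace ℂ d) :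
    Torus.convectionCoeff S C C' 0 = 0 := by
  rw [Torus.convectionCoeff_def]
  refine Finset.sum_eq_zero fun l hl => Finset.sum_eq_zero fun m _ => ?_
  split_ifs with hlm
  · have hm : m = -l := eq_neg_of_add_eq_zero_right hlm
    have h0 : ∑ j, C l j * (m j : ℂ) = 0 := by
      subst hm
      have h := hC l hl
      simp only [Pi.neg_apply, Int.cast_neg, mul_neg, Finset.sum_neg_distrib, neg_eq_zero]
      rw [← h]
      exact Finset.sum_congr rfl fun j _ => mul_comm _ _
    rw [h0, mul_zero, zero_smul]
  · rfl

/-- The `k = 0` component of the Galerkin vector field `galerkinRHS S ν g c` vanishes whenever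
`c` is divergence free (transversal) and the force has no mean mode (`g 0 = 0`): the Stokes
multiplier is `ν · 4π² · |0|² = 0`, and the Leray multiplier is applied to `g 0 - B(c, c)_0 = 0`. -/
theorem galerkinRHS_apply_eq_zero_of_coe_eq_zero {d : Type*} [Fintype d] [DecidableEq d]
    {S : Finset (d → ℤ)} (ν : ℝ) {g c : ↥S → EuclideanSpace ℂ d} (hc : IsSolenoidalCoeff c)
    {k : ↥S} (hk : (k : d → ℤ) = 0) (hg : g k = 0) :
    galerkinRHS S ν g c k = 0 := by
  have hconv : Torus.convectionCoeff S (coeffExt S c) (coeffExt S c) (k : d → ℤ) = 0 := by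
    rw [hk]
    exact convectionCoeff_zero_freq_of_isTransversal hc.isTransversal_coeffExt _
  have hvisc : ((ν * (4 * Real.pi ^ 2 * freqNormSq (k : d → ℤ)) : ℝ) : ℂ) = 0 := by
    rw [hk, freqNormSq_zero, mul_zero, mul_zero, Complex.ofReal_zero]
  rw [galerkinRHS_apply, Torus.galerkinField_def, hvisc, zero_smul, neg_zero, zero_add, hconv,
    sub_zero, coeffExt_coe, hg, Torus.leraySym_zero]

/-- The zero Fourier mode of a mean-zero real vector field vanishes:
`𝓕(complexify ∘ f)(0) = complexify (∫ f) = 0`. -/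
theorem mFourierCoeff_complexify_zero_of_hasZeroMean {d : Type*} [Fintype d]
    {f : UnitAddTorus d → EuclideanSpace ℝ d} (h0 : Torus.HasZeroMean f) :
    UnitAddTorus.mFourierCoeff (EuclideanSpace.complexify ∘ f) 0 = 0 := by
  rw [mFourierCoeff_eq_integral_volume]
  simp only [neg_zero, UnitAddTorus.mFourier_zero, ContinuousMap.one_apply, one_smul,
    Function.comp_apply]
  rw [EuclideanSpace.complexify.integral_comp_comm f, show (∫ x, f x) = 0 from h0, map_zero]

/-- **The mean mode is conserved by the Galerkin phase semiflow.** For `ν ≥ 0`, an integrable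
mean-zero force `f` and a phase point `x` with vanishing mean mode, the mean mode vanishes along
the whole forward orbit `t ↦ galerkinPhaseFlow ν (f̂|_{≤N}) t x`, `t ≥ 0` (the `k = 0` component
of `galerkinRHS` vanishes, `galerkinRHS_apply_eq_zero_of_coe_eq_zero`, so the mean coordinate of
the orbit has zero right derivative and is constant, `constant_of_has_deriv_right_zero`). -/
theorem stub_meanZeroInvariant :
    ∀ (ν : ℝ) (N : ℕ) (f : UnitAddTorus (Fin 3) → EuclideanSpace ℝ (Fin 3))
      (x : ↥(galerkinSubspace (freqBall N : Finset (Fin 3 → ℤ)))) (t : ℝ),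
      0 ≤ ν → Integrable f volume → Torus.HasZeroMean f →
      (∀ k : ↥(freqBall N : Finset (Fin 3 → ℤ)), (k : Fin 3 → ℤ) = 0 →
        (x : ↥(freqBall N : Finset (Fin 3 → ℤ)) → EuclideanSpace ℂ (Fin 3)) k = 0) → 0 ≤ t →
      ∀ k : ↥(freqBall N : Finset (Fin 3 → ℤ)), (k : Fin 3 → ℤ) = 0 →
        (galerkinPhaseFlow ν (fourierRestrict (freqBall N : Finset (Fin 3 → ℤ)) f) t x :
          ↥(freqBall N : Finset (Fin 3 → ℤ)) → EuclideanSpace ℂ (Fin 3)) k = 0 := by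
  intro ν N f x t hν hf hmean hx ht k hk
  -- the force coefficients are real and have no mean mode
  have hg : IsRealCoeff (fourierRestrict (freqBall N : Finset (Fin 3 → ℤ)) f) :=
    isRealCoeff_mFourierCoeff hf
  have hg0 : fourierRestrict (freqBall N : Finset (Fin 3 → ℤ)) f k = 0 := by
    rw [fourierRestrict_apply, hk]
    exact mFourierCoeff_complexify_zero_of_hasZeroMean hmean
  -- the forward orbit is a global solution of the Galerkin ODE
  have hsol : IsGalerkinODESolution ν (fourierRestrict (freqBall N : Finset (Fin 3 → ℤ)) f)
      (x : ↥(freqBall N : Finset (Fin 3 → ℤ)) → EuclideanSpace ℂ (Fin 3))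
      (fun s => galerkinCoeffFlow ν (fourierRestrict (freqBall N : Finset (Fin 3 → ℤ)) f) s
        (x : ↥(freqBall N : Finset (Fin 3 → ℤ)) → EuclideanSpace ℂ (Fin 3))) :=
    isGalerkinODESolution_galerkinCoeffFlow hν neg_mem_freqBall_of_mem hg x.2
  -- its mean coordinate has zero right derivative on `[0, t)` and is continuous on `[0, t]`
  have hderiv : ∀ s ∈ Ico 0 t, HasDerivWithinAt
      (fun s => galerkinCoeffFlow ν (fourierRestrict (freqBall N : Finset (Fin 3 → ℤ)) f) s
        (x : ↥(freqBall N : Finset (Fin 3 → ℤ)) → EuclideanSpace ℂ (Fin 3)) k) 0 (Ici s) s := by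
    intro s hs
    have h := (hasDerivWithinAt_pi.1 (hsol.hasDerivWithinAt_Ici hs)) k
    rwa [galerkinRHS_apply_eq_zero_of_coe_eq_zero ν (hsol.mem s).2 hk hg0] at h
  have hcont : ContinuousOn
      (fun s => galerkinCoeffFlow ν (fourierRestrict (freqBall N : Finset (Fin 3 → ℤ)) f) s
        (x : ↥(freqBall N : Finset (Fin 3 → ℤ)) → EuclideanSpace ℂ (Fin 3)) k) (Icc 0 t) :=
    (continuous_apply k).comp_continuousOn (hsol.continuousOn.mono Icc_subset_Ici_self)
  -- hence it is constant, equal to its (vanishing) initial value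
  have h := constant_of_has_deriv_right_zero hcont hderiv t ⟨ht, le_rfl⟩
  rw [coe_galerkinPhaseFlow, h, galerkinCoeffFlow_zero]
  exact hx k hk

end Summit.AnomalousDissipation.AnomalousDissipation.Theorems.UniformGalerkinTrap.Sketch
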